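import Literature.AlgebraicGeometry.Motives.TateConjectureKunnethFullyAlgebraicFactor
import Literature.AlgebraicGeometry.Motives.SimplePoleTateConjecture
import HarnessLib

/-!
# Tate's conjecture for the quadrics of `ℙ^{2l+3}` times a projective space over `𝔽_q`:
# `T(ℰ × 𝐏ʳ)` in every codimension; `Tᶜ(ℋ × 𝐏ʳ) ⟺ T^{l+1}(ℋ)` in the window `l+1 ≤ c ≤ l+1+r`

Topic `Literature/AlgebraicGeometry/Motives`; THEOREMS ONLY (no definition, no instance, no named fact;
D-0026).

Row g52-#2 (`SimplePoleTateConjecture`) proved Tate's conjecture for the elliptic quadric `ℰ_{2l+3} ⊂ ℙ^{2l+3}_{𝔽_q}`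
(`ε` a non-square; Hirschfeld 1998 Thm. 5.2.6, Kahn 2020 Remark 3.66) in EVERY codimension and for the hyperbolic
quadric `ℋ_{2l+3}` off the middle codimension `l+1`, by the SIMPLE-POLE argument (Tate 1965 §3 (12)–(13): the
pole order of `Z(X,T)` at `q^{−r}` bounds the rank, and a simple pole forces `Tʳ`).  For the products `ℰ × 𝐏ʳ`,
`ℋ × 𝐏ʳ` that argument is NOT available: by the projective bundle formula the pole of `Z(ℰ × 𝐏ʳ, T)` at
`q^{−c}` has order `#{q ≤ r : c − q ≤ 2l+2}` (row g52-#11), `> 1` in general.  Row g53-#2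
(`TateConjectureKunnethFullyAlgebraicFactor`: `Tᶜ(X × 𝐏ʳ) ⟺ Tᵖ(X)` for `c − r ≤ p ≤ c`, the Künneth
comparison of Milne 2007 Cor. 2.2 in all codimensions) gives them at once:

* §1 **`Tᶜ(ℰ × 𝐏ʳ)` and `Tᶜ(𝐏ʳ × ℰ)` for every `c`** (`tateConjectureFor_ellipticQuadric_tensor_projectiveSpace`,
  `tateConjectureFor_projectiveSpace_tensor_ellipticQuadric`), and `Tᶜ(ℰ × 𝐏ᵃ × 𝐏ʳ)`
  (`tateConjectureFor_ellipticQuadric_tensor_projectiveSpace_tensor_projectiveSpace`).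
* §2 the hyperbolic quadric: **`Tᶜ(ℋ × 𝐏ʳ)` whenever the window `[c − r, c]` avoids the middle codimension
  `l + 1`** (`tateConjectureFor_splitQuadric_tensor_projectiveSpace_of_forall_ne`, `_of_lt` for `c < l+1`,
  `_of_lt'` for `l+1+r < c`); **in the window `l+1 ≤ c ≤ l+1+r`, `Tᶜ(ℋ × 𝐏ʳ) ⟺ T^{l+1}(ℋ)`**
  (`tateConjectureFor_splitQuadric_tensor_projectiveSpace_iff`), so two independent algebraic middle classes on
  `ℋ` (`dim K·A^{l+1}(ℋ) = 2`, the two rulings of Kahn's Remark 3.66) give `T(ℋ × 𝐏ʳ)` in every codimension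
  (`tateConjectureFor_splitQuadric_tensor_projectiveSpace_of_finrank_eq_two`).

All in the tree's Galois Weil cohomology `E` over the finite field `k` (`q = #k`), under the Lefschetz trace formula
`hE`, `χ(φ) = q`, and the Riemann hypothesis in `E` for the quadric and for `𝐏ʳ` (hypotheses of the rows used).
HC is not touched.

## References

* [Tate1994] J. Tate, *Conjectures on algebraic cycles in ℓ-adic cohomology*, PSPM 55.1 (1994), §1 (Conjecture
  `Tᵖ`), §2 Th. 2.9.
* [TateWoodsHole1965] J. Tate, *Algebraic cycles and poles of zeta functions* (1965), §3 (12)–(13).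
* [Milne2007TateFiniteFieldsAIM] J. S. Milne, *The Tate conjecture over finite fields (AIM talk)*,
  arXiv:0709.3040, §2 Cor. 2.2.
* [Kahn2020] B. Kahn, *Zeta and L-Functions of Varieties and Motives* (2020), §3.6 Remark 3.66 (the quadric
  and its rulings), §6.4 Prop. 6.11 (6.4.1).
* [Hirschfeld1998] J. W. P. Hirschfeld, *Projective Geometries over Finite Fields*, 2nd ed. (1998), §5.2
  Thm. 5.2.4, Thm. 5.2.6.
* Tree: `TateConjectureKunnethFullyAlgebraicFactor` (g53-#2), `SimplePoleTateConjecture` (g52-#2: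
  `tateConjectureFor_ellipticQuadric`, `tateConjectureFor_splitQuadric_of_ne`,
  `consequences_splitQuadric_middle_of_finrank_eq_two`), `QuadricNormalFormsSmooth` (g52-#1),
  `ProjectiveSpaceFiniteFieldCohomology`.

## Provenance

Lane `lit-hodgefound` (summit `HodgeConjecture`, Track 2 foundations library, Layer B: motives ∕ Tate's
conjecture over finite fields), seat `lit-hodgefound-p29` (literature-prover, generation 53, row g53-#3).
-/

universe u v

open CategoryTheory AlgebraicGeometry MonoidalCategory

noncomputable section

namespace Literature.AlgebraicGeometry.Motives

namespace GaloisWeilCohomology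

open SmoothHypersurface (hypersurface)

variable {k : Type u} [Field k] [Finite k] {K : Type v} [Field K] [CharZero K]
  {χ : Field.absoluteGaloisGroup k →* Kˣ} (E : GaloisWeilCohomology k K χ)

/-! ### §1 The elliptic quadric `ℰ_{2l+3}` times `𝐏ʳ` -/

section EllipticQuadric

variable (l : ℕ) {ε : k} {r : ℕ}

/-- `l + 1 ≤ 2l + 2 + 2` (any proof matches the tree's by proof irrelevance). [folklore] -/
private theorem leE (l : ℕ) : l + 1 ≤ 2 * l + 2 + 2 := by omega

/-- The middle coordinate `l + 1`. [folklore] -/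
private theorem ltE₁ (l : ℕ) : l + 1 < 2 * l + 2 + 2 := by omega

/-- The middle coordinate `l + 2`. [folklore] -/
private theorem ltE₂ (l : ℕ) : l + 2 < 2 * l + 2 + 2 := by omega

/-- **`Tᶜ(ℰ × 𝐏ʳ)` for every `c`**: the elliptic quadric `ℰ_{2l+3} = V₊(Σ_{i≤l} xᵢx_{2l+3−i} + x_{l+1}² − εx_{l+2}²)
⊂ ℙ^{2l+3}_{𝔽_q}` (`ε` a non-square) satisfies `T` in every codimension (row g52-#2), hence so does `ℰ × 𝐏ʳ`
(`Tᶜ(X × 𝐏ʳ) ⟺ Tᵖ(X)`, `c − r ≤ p ≤ c`), although the poles of `Z(ℰ × 𝐏ʳ, T)` are no longer simple.  In `E`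
with the trace formula, `χ(φ) = q`, RH for `ℰ` and for `𝐏ʳ`. [cite: Tate1994, §1 (Conjecture Tᵖ)]
[cite: Milne2007TateFiniteFieldsAIM, Cor. 2.2] [cite: Kahn2020, §3.6 Remark 3.66] [cite: Hirschfeld1998, §5.2 Thm. 5.2.6] -/
theorem tateConjectureFor_ellipticQuadric_tensor_projectiveSpace (hE : E.HasLefschetzTraceFormula)
    (hχ : ((χ (arithFrob k) : Kˣ) : K) = Nat.card k) (hε : ¬IsSquare ε)
    (hRH : E.WeilRiemannHypothesisFor
      (hypersurface ((∑ i : Fin (l + 1), MvPolynomial.X (Fin.castLE (leE l) i) *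
          MvPolynomial.X (Fin.rev (Fin.castLE (leE l) i))) + MvPolynomial.X (Fin.mk (l + 1) (ltE₁ l)) ^ 2 -
          MvPolynomial.C ε * MvPolynomial.X (Fin.mk (l + 2) (ltE₂ l)) ^ 2 : MvPolynomial (Fin (2 * l + 2 + 2)) k))
      (2 * l + 2))
    (hRHP : E.WeilRiemannHypothesisFor (projectiveSpace r k) r) (c : ℕ) :
    E.TateConjectureFor
      (hypersurface ((∑ i : Fin (l + 1), MvPolynomial.X (Fin.castLE (leE l) i) *
          MvPolynomial.X (Fin.rev (Fin.castLE (leE l) i))) + MvPolynomial.X (Fin.mk (l + 1) (ltE₁ l)) ^ 2 -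
          MvPolynomial.C ε * MvPolynomial.X (Fin.mk (l + 2) (ltE₂ l)) ^ 2 : MvPolynomial (Fin (2 * l + 2 + 2)) k) ⊗
        projectiveSpace r k) c :=
  E.tateConjectureFor_tensor_projectiveSpace hE hχ hRHP (isSmoothProjective_ellipticQuadric_of_not_isSquare l hε)
    (E.tateConjectureFor_ellipticQuadric l hE hχ hε hRH) c

/-- **`Tᶜ(𝐏ʳ × ℰ)` for every `c`** (braiding). [cite: Tate1994, §1 (Conjecture Tᵖ)] [cite: Milne2007TateFiniteFieldsAIM, Cor. 2.2]
[cite: Hirschfeld1998, §5.2 Thm. 5.2.6] -/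
theorem tateConjectureFor_projectiveSpace_tensor_ellipticQuadric (hE : E.HasLefschetzTraceFormula)
    (hχ : ((χ (arithFrob k) : Kˣ) : K) = Nat.card k) (hε : ¬IsSquare ε)
    (hRH : E.WeilRiemannHypothesisFor
      (hypersurface ((∑ i : Fin (l + 1), MvPolynomial.X (Fin.castLE (leE l) i) *
          MvPolynomial.X (Fin.rev (Fin.castLE (leE l) i))) + MvPolynomial.X (Fin.mk (l + 1) (ltE₁ l)) ^ 2 -
          MvPolynomial.C ε * MvPolynomial.X (Fin.mk (l + 2) (ltE₂ l)) ^ 2 : MvPolynomial (Fin (2 * l + 2 + 2)) k))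
      (2 * l + 2))
    (hRHP : E.WeilRiemannHypothesisFor (projectiveSpace r k) r) (c : ℕ) :
    E.TateConjectureFor (projectiveSpace r k ⊗
      hypersurface ((∑ i : Fin (l + 1), MvPolynomial.X (Fin.castLE (leE l) i) *
          MvPolynomial.X (Fin.rev (Fin.castLE (leE l) i))) + MvPolynomial.X (Fin.mk (l + 1) (ltE₁ l)) ^ 2 -
          MvPolynomial.C ε * MvPolynomial.X (Fin.mk (l + 2) (ltE₂ l)) ^ 2 : MvPolynomial (Fin (2 * l + 2 + 2)) k)) c :=
  E.tateConjectureFor_projectiveSpace_tensor hE hχ hRHP (isSmoothProjective_ellipticQuadric_of_not_isSquare l hε)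
    (E.tateConjectureFor_ellipticQuadric l hE hχ hε hRH) c

/-- **`Tᶜ(ℰ × 𝐏ᵃ × 𝐏ʳ)` for every `c`** (iterate). [cite: Tate1994, §1 (Conjecture Tᵖ)]
[cite: Milne2007TateFiniteFieldsAIM, Cor. 2.2] [cite: TateWoodsHole1965, §3 (13)] -/
theorem tateConjectureFor_ellipticQuadric_tensor_projectiveSpace_tensor_projectiveSpace
    (hE : E.HasLefschetzTraceFormula) (hχ : ((χ (arithFrob k) : Kˣ) : K) = Nat.card k) (hε : ¬IsSquare ε)
    (hRH : E.WeilRiemannHypothesisFor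
      (hypersurface ((∑ i : Fin (l + 1), MvPolynomial.X (Fin.castLE (leE l) i) *
          MvPolynomial.X (Fin.rev (Fin.castLE (leE l) i))) + MvPolynomial.X (Fin.mk (l + 1) (ltE₁ l)) ^ 2 -
          MvPolynomial.C ε * MvPolynomial.X (Fin.mk (l + 2) (ltE₂ l)) ^ 2 : MvPolynomial (Fin (2 * l + 2 + 2)) k))
      (2 * l + 2))
    {a : ℕ} (hRHa : E.WeilRiemannHypothesisFor (projectiveSpace a k) a)
    (hRHP : E.WeilRiemannHypothesisFor (projectiveSpace r k) r) (c : ℕ) :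
    E.TateConjectureFor
      ((hypersurface ((∑ i : Fin (l + 1), MvPolynomial.X (Fin.castLE (leE l) i) *
          MvPolynomial.X (Fin.rev (Fin.castLE (leE l) i))) + MvPolynomial.X (Fin.mk (l + 1) (ltE₁ l)) ^ 2 -
          MvPolynomial.C ε * MvPolynomial.X (Fin.mk (l + 2) (ltE₂ l)) ^ 2 : MvPolynomial (Fin (2 * l + 2 + 2)) k) ⊗
        projectiveSpace a k) ⊗ projectiveSpace r k) c :=
  E.tateConjectureFor_tensor_projectiveSpace hE hχ hRHP
    (IsSmoothProjective.tensor_holds (isSmoothProjective_ellipticQuadric_of_not_isSquare l hε)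
      (isSmoothProjective_projectiveSpace_holds k a))
    (E.tateConjectureFor_ellipticQuadric_tensor_projectiveSpace l hE hχ hε hRH hRHa) c

end EllipticQuadric

/-! ### §2 The hyperbolic quadric `ℋ_{2l+3}` times `𝐏ʳ` -/

section SplitQuadric

variable (l : ℕ) (ε : Fin (l + 2) → kˣ) {r : ℕ}

/-- `l + 2 ≤ 2l + 2 + 2` (any proof matches the tree's by proof irrelevance). [folklore] -/
private theorem leS (l : ℕ) : l + 2 ≤ 2 * l + 2 + 2 := by omega

/-- **`Tᶜ(ℋ × 𝐏ʳ)` whenever the window `[c − r, c]` avoids the middle codimension `l + 1`**: for the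
hyperbolic quadric `ℋ_{2l+3} = V₊(Σ εᵢxᵢx_{2l+3−i}) ⊂ ℙ^{2l+3}_{𝔽_q}`, `Tᵖ(ℋ)` holds for every `p ≠ l+1`
(simple poles off the middle, row g52-#2), and `Tᶜ(X × 𝐏ʳ) ⟺ Tᵖ(X)` for `c − r ≤ p ≤ c`.  In `E` with the
trace formula, `χ(φ) = q`, RH for `ℋ` and for `𝐏ʳ`. [cite: Tate1994, §1 (Conjecture Tᵖ) and §2 Th. 2.9]
[cite: Milne2007TateFiniteFieldsAIM, Cor. 2.2] [cite: Kahn2020, §3.6 Remark 3.66] [cite: Hirschfeld1998, §5.2 Thm. 5.2.4] -/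
theorem tateConjectureFor_splitQuadric_tensor_projectiveSpace_of_forall_ne (hE : E.HasLefschetzTraceFormula)
    (hχ : ((χ (arithFrob k) : Kˣ) : K) = Nat.card k)
    (hRH : E.WeilRiemannHypothesisFor
      (hypersurface (∑ i : Fin (l + 2), MvPolynomial.C (ε i : k) * MvPolynomial.X (Fin.castLE (leS l) i) *
          MvPolynomial.X (Fin.rev (Fin.castLE (leS l) i)) : MvPolynomial (Fin (2 * l + 2 + 2)) k)) (2 * l + 2))
    (hRHP : E.WeilRiemannHypothesisFor (projectiveSpace r k) r) {c : ℕ}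
    (hc : ∀ p q : ℕ, p + q = c → q ≤ r → p ≠ l + 1) :
    E.TateConjectureFor
      (hypersurface (∑ i : Fin (l + 2), MvPolynomial.C (ε i : k) * MvPolynomial.X (Fin.castLE (leS l) i) *
          MvPolynomial.X (Fin.rev (Fin.castLE (leS l) i)) : MvPolynomial (Fin (2 * l + 2 + 2)) k) ⊗
        projectiveSpace r k) c :=
  E.tateConjectureFor_tensor_projectiveSpace_of_forall hE hχ hRHP (isSmoothProjective_splitQuadric l ε)
    fun p q hpq hq ↦ E.tateConjectureFor_splitQuadric_of_ne l ε hE hχ hRH (hc p q hpq hq)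

/-- **`Tᶜ(ℋ × 𝐏ʳ)` for `c < l + 1`** (the window lies below the middle). [cite: Tate1994, §1 (Conjecture Tᵖ)]
[cite: Milne2007TateFiniteFieldsAIM, Cor. 2.2] [cite: Kahn2020, §3.6 Remark 3.66] -/
theorem tateConjectureFor_splitQuadric_tensor_projectiveSpace_of_lt (hE : E.HasLefschetzTraceFormula)
    (hχ : ((χ (arithFrob k) : Kˣ) : K) = Nat.card k)
    (hRH : E.WeilRiemannHypothesisFor
      (hypersurface (∑ i : Fin (l + 2), MvPolynomial.C (ε i : k) * MvPolynomial.X (Fin.castLE (leS l) i) *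
          MvPolynomial.X (Fin.rev (Fin.castLE (leS l) i)) : MvPolynomial (Fin (2 * l + 2 + 2)) k)) (2 * l + 2))
    (hRHP : E.WeilRiemannHypothesisFor (projectiveSpace r k) r) {c : ℕ} (hc : c < l + 1) :
    E.TateConjectureFor
      (hypersurface (∑ i : Fin (l + 2), MvPolynomial.C (ε i : k) * MvPolynomial.X (Fin.castLE (leS l) i) *
          MvPolynomial.X (Fin.rev (Fin.castLE (leS l) i)) : MvPolynomial (Fin (2 * l + 2 + 2)) k) ⊗
        projectiveSpace r k) c :=
  E.tateConjectureFor_splitQuadric_tensor_projectiveSpace_of_forall_ne l ε hE hχ hRH hRHP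
    fun p q hpq _ ↦ by omega

/-- **`Tᶜ(ℋ × 𝐏ʳ)` for `l + 1 + r < c`** (the window lies above the middle). [cite: Tate1994, §1 (Conjecture Tᵖ)]
[cite: Milne2007TateFiniteFieldsAIM, Cor. 2.2] [cite: Kahn2020, §3.6 Remark 3.66] -/
theorem tateConjectureFor_splitQuadric_tensor_projectiveSpace_of_lt' (hE : E.HasLefschetzTraceFormula)
    (hχ : ((χ (arithFrob k) : Kˣ) : K) = Nat.card k)
    (hRH : E.WeilRiemannHypothesisFor
      (hypersurface (∑ i : Fin (l + 2), MvPolynomial.C (ε i : k) * MvPolynomial.X (Fin.castLE (leS l) i) *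
          MvPolynomial.X (Fin.rev (Fin.castLE (leS l) i)) : MvPolynomial (Fin (2 * l + 2 + 2)) k)) (2 * l + 2))
    (hRHP : E.WeilRiemannHypothesisFor (projectiveSpace r k) r) {c : ℕ} (hc : l + 1 + r < c) :
    E.TateConjectureFor
      (hypersurface (∑ i : Fin (l + 2), MvPolynomial.C (ε i : k) * MvPolynomial.X (Fin.castLE (leS l) i) *
          MvPolynomial.X (Fin.rev (Fin.castLE (leS l) i)) : MvPolynomial (Fin (2 * l + 2 + 2)) k) ⊗
        projectiveSpace r k) c :=
  E.tateConjectureFor_splitQuadric_tensor_projectiveSpace_of_forall_ne l ε hE hχ hRH hRHP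
    fun p q hpq hq ↦ by omega

/-- **In the window `l + 1 ≤ c ≤ l + 1 + r`: `Tᶜ(ℋ × 𝐏ʳ) ⟺ T^{l+1}(ℋ)`** — the only codimension of `ℋ` in
`[c − r, c]` where `T` is not settled by the simple-pole argument is the middle one (pole of order `2`; Tate's
theorem there reads `T^{l+1}(ℋ) ∧ E ⟺ ρ_{l+1}(ℋ) = 2`, row g52-#2). [cite: Tate1994, §1 (Conjecture Tᵖ) and §2 Th. 2.9]
[cite: Milne2007TateFiniteFieldsAIM, Cor. 2.2] [cite: Kahn2020, §3.6 Remark 3.66] -/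
theorem tateConjectureFor_splitQuadric_tensor_projectiveSpace_iff (hE : E.HasLefschetzTraceFormula)
    (hχ : ((χ (arithFrob k) : Kˣ) : K) = Nat.card k)
    (hRH : E.WeilRiemannHypothesisFor
      (hypersurface (∑ i : Fin (l + 2), MvPolynomial.C (ε i : k) * MvPolynomial.X (Fin.castLE (leS l) i) *
          MvPolynomial.X (Fin.rev (Fin.castLE (leS l) i)) : MvPolynomial (Fin (2 * l + 2 + 2)) k)) (2 * l + 2))
    (hRHP : E.WeilRiemannHypothesisFor (projectiveSpace r k) r) {c : ℕ} (h₁ : l + 1 ≤ c) (h₂ : c ≤ l + 1 + r) :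
    E.TateConjectureFor
        (hypersurface (∑ i : Fin (l + 2), MvPolynomial.C (ε i : k) * MvPolynomial.X (Fin.castLE (leS l) i) *
          MvPolynomial.X (Fin.rev (Fin.castLE (leS l) i)) : MvPolynomial (Fin (2 * l + 2 + 2)) k) ⊗
          projectiveSpace r k) c ↔
      E.TateConjectureFor
        (hypersurface (∑ i : Fin (l + 2), MvPolynomial.C (ε i : k) * MvPolynomial.X (Fin.castLE (leS l) i) *
          MvPolynomial.X (Fin.rev (Fin.castLE (leS l) i)) : MvPolynomial (Fin (2 * l + 2 + 2)) k)) (l + 1) := by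
  rw [E.tateConjectureFor_tensor_projectiveSpace_iff hE hχ hRHP (isSmoothProjective_splitQuadric l ε)]
  refine ⟨fun h ↦ h (l + 1) (c - (l + 1)) (by omega) (by omega), fun h p q hpq hq ↦ ?_⟩
  by_cases hp : p = l + 1
  · subst hp
    exact h
  · exact E.tateConjectureFor_splitQuadric_of_ne l ε hE hχ hRH hp

/-- **Two independent algebraic middle classes on `ℋ` (`dim K·A^{l+1}(ℋ) = 2`; the two rulings) give
`T(ℋ × 𝐏ʳ)` in every codimension.** [cite: Kahn2020, §3.6 Remark 3.66 and §6.14 Th. 6.53]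
[cite: Tate1994, §2 Th. 2.9] [cite: Milne2007TateFiniteFieldsAIM, Cor. 2.2] -/
theorem tateConjectureFor_splitQuadric_tensor_projectiveSpace_of_finrank_eq_two (hE : E.HasLefschetzTraceFormula)
    (hχ : ((χ (arithFrob k) : Kˣ) : K) = Nat.card k)
    (hRH : E.WeilRiemannHypothesisFor
      (hypersurface (∑ i : Fin (l + 2), MvPolynomial.C (ε i : k) * MvPolynomial.X (Fin.castLE (leS l) i) *
          MvPolynomial.X (Fin.rev (Fin.castLE (leS l) i)) : MvPolynomial (Fin (2 * l + 2 + 2)) k)) (2 * l + 2))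
    (hRHP : E.WeilRiemannHypothesisFor (projectiveSpace r k) r)
    (h2 : Module.finrank K (E.algebraicClasses
      (hypersurface (∑ i : Fin (l + 2), MvPolynomial.C (ε i : k) * MvPolynomial.X (Fin.castLE (leS l) i) *
          MvPolynomial.X (Fin.rev (Fin.castLE (leS l) i)) : MvPolynomial (Fin (2 * l + 2 + 2)) k)) (l + 1)) = 2)
    (c : ℕ) :
    E.TateConjectureFor
      (hypersurface (∑ i : Fin (l + 2), MvPolynomial.C (ε i : k) * MvPolynomial.X (Fin.castLE (leS l) i) *
          MvPolynomial.X (Fin.rev (Fin.castLE (leS l) i)) : MvPolynomial (Fin (2 * l + 2 + 2)) k) ⊗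
        projectiveSpace r k) c := by
  refine E.tateConjectureFor_tensor_projectiveSpace hE hχ hRHP (isSmoothProjective_splitQuadric l ε)
    (fun p ↦ ?_) c
  by_cases hp : p = l + 1
  · subst hp
    exact (E.consequences_splitQuadric_middle_of_finrank_eq_two l ε hE hχ hRH h2).1
  · exact E.tateConjectureFor_splitQuadric_of_ne l ε hE hχ hRH hp

end SplitQuadric

end GaloisWeilCohomology

end Literature.AlgebraicGeometry.Motives

end
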